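import Literature.Analysis.TotalPositivity.PolyaFrequencyStripping
import Literature.Analysis.TotalPositivity.PolyaFrequencyReciprocal
import Literature.Analysis.TotalPositivity.ASWERepresentation
import Literature.Analysis.Complex.HolomorphicPrimitives
import HarnessLib

/-!
# Aissen–Schoenberg–Whitney's Theorem 2 (meromorphic continuation of a PF generating function)
# from Ando's recognition theorem — proved

Trunk T-ANALYSIS (Literature/Analysis/TotalPositivity). Part 4b of the decomposition of the named
fact `Literature.Analysis.TotalPositivity.aswe_edrei`. We discharge the named fact `asw1952_representation`
(ASWERepresentation.lean) = [AissenEdreiSchoenbergWhitney1951, Thm. 2] (Aissen–Schoenberg–Whitney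
1952) from the finite-dimensional named fact `ando1987_lowerTriangular_tn` [Ando1987, Cor. 2.2]:

> `asw1952_representation_of_ando : ando1987_lowerTriangular_tn → asw1952_representation`,

and hence `aswe_edrei_of_ando : ando1987_lowerTriangular_tn → edrei1952_exponential_factor →
aswe_edrei`.

## The proof (elementary; replaces Hadamard's polar-singularity theory of the printed proof)

Let `a` be PF with `a₀ = 1`, `f(z) = Σ aₙ zⁿ`.
* A. `b = negRecipSeq a` (Taylor sequence of `g(z) = 1/f(-z)`) is PF (reciprocal rule,
  PolyaFrequencyReciprocal.lean). Strip all poles of `g` (PolyaFrequencyStripping.lean): `αᵢ ≥ 0`,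
  `Σ αᵢ < ∞`, and an ENTIRE `G(z) = Σ γₙ zⁿ` with PF Taylor sequence, `G > 0` on `[0, ∞)`, and
  `G(z) = g(z) ∏ (1 - αᵢ z)` near `0`; so `G(-z) = g(-z) P_α(z)`, `P_α(z) = ∏ (1 + αᵢ z)`.
* B. `c = negRecipSeq γ` (Taylor sequence of `1/G(-z) = f(z)/P_α(z)`, "`f` without its zeros")
  is PF.
* C. Strip all poles of `Σ cₙ zⁿ`: `βⱼ ≥ 0`, `Σ βⱼ < ∞`, an entire `E(z) = Σ εₙ zⁿ` with PF Taylor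
  sequence `ε`, `E > 0` on `[0, ∞)`, `E(z) = (Σ cₙ zⁿ) Q_β(z)` near `0`, `Q_β(z) = ∏ (1 - βⱼ z)`.
* D. Near `0`, `(Σ cₙ zⁿ) G(-z) = 1`, hence `E(z) G(-z) = Q_β(z)`; by the identity theorem this
  holds on `ℂ`, so every zero of `E` is a zero `1/βⱼ > 0` of `Q_β` — impossible as `E > 0` there.
  Thus `E` is entire and zero-free, `E = e^{g̃}` with `g̃` entire (Conway VIII.2.2 on `ℂ`,
  `Complex.exists_eq_exp_of_forall_isExactOn`), and `e^{g̃}` generates the PF sequence `ε`.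
* E. Near `0`: `f(z) g(-z) = 1`, `G(-z) = g(-z) P_α(z)`, `(Σ cₙ zⁿ) G(-z) = 1`, `E = (Σ cₙ zⁿ) Q_β`
  give `Σ aₙ zⁿ = e^{g̃(z)} P_α(z)/Q_β(z)` — Theorem 2.

## References

* M. Aissen, A. Edrei, I. J. Schoenberg, A. Whitney, Proc. Nat. Acad. Sci. USA 37 (1951)
  303–307, Thms. 2, 4. [AissenEdreiSchoenbergWhitney1951]
* M. Aissen, I. J. Schoenberg, A. M. Whitney, J. Analyse Math. 2 (1952) 93–103.
  [AissenSchoenbergWhitney1952]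
* T. Ando, Linear Algebra Appl. 90 (1987) 165–219, Cor. 2.2. [Ando1987]
* J. B. Conway, *Functions of One Complex Variable I* (1978), Thm. VIII.2.2. [Conway1978]
-/

noncomputable section

open Filter Finset Metric Complex
open scoped Topology

namespace Literature.Analysis.TotalPositivity

/-! ### Power series helpers -/

/-- A power series with real coefficients converging on all of `ℂ` defines an entire function.
[folklore] -/
theorem differentiable_tsum_of_summable {c : ℕ → ℝ}
    (hs : ∀ z : ℂ, Summable fun n => ‖(c n : ℂ) * z ^ n‖) :
    Differentiable ℂ fun z => ∑' n, (c n : ℂ) * z ^ n := by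
  intro z
  have hr : 0 < ‖z‖ + 1 := by positivity
  have H := hasFPowerSeriesOnBall_of_hasSum (h := fun z => ∑' n, (c n : ℂ) * z ^ n)
    (c := fun n => (c n : ℂ)) hr (fun w _ => (hs w).of_norm.hasSum)
  have hz : z ∈ Metric.eball (0 : ℂ) (ENNReal.ofReal (‖z‖ + 1)) := by
    rw [Metric.eball_ofReal, Metric.mem_ball, dist_zero_right]
    linarith
  exact (H.analyticAt_of_mem hz).differentiableAt

/-- **`f(z) · Σ (recipSeq a)ₙ zⁿ = 1`** wherever both series converge absolutely (Cauchy product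
and `Σ_{k≤n} a_k recipSeq a (n-k) = δ_{n0}`). [folklore] -/
theorem tsum_mul_tsum_recipSeq {a : ℕ → ℝ} (h0 : a 0 = 1) {z : ℂ}
    (ha : Summable fun n => ‖(a n : ℂ) * z ^ n‖)
    (hr : Summable fun n => ‖(recipSeq a n : ℂ) * z ^ n‖) :
    (∑' n, (a n : ℂ) * z ^ n) * ∑' n, (recipSeq a n : ℂ) * z ^ n = 1 := by
  rw [tsum_mul_tsum_eq_tsum_sum_range_of_summable_norm ha hr]
  have hterm : ∀ n, ∑ k ∈ Finset.range (n + 1), (a k : ℂ) * z ^ k *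
      ((recipSeq a (n - k) : ℂ) * z ^ (n - k)) = if n = 0 then 1 else 0 := by
    intro n
    have h := sum_mul_recipSeq (a := a) (by rw [h0]; exact one_ne_zero) n
    have h1 : ∑ k ∈ Finset.range (n + 1), (a k : ℂ) * z ^ k * ((recipSeq a (n - k) : ℂ) * z ^ (n - k))
        = ((∑ k ∈ Finset.range (n + 1), a k * recipSeq a (n - k) : ℝ) : ℂ) * z ^ n := by
      push_cast
      rw [Finset.sum_mul]
      refine Finset.sum_congr rfl fun k hk => ?_
      rw [Finset.mem_range] at hk
      rw [← pow_mul_pow_sub z (Nat.le_of_lt_succ hk)]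
      ring
    rw [h1, h]
    split_ifs with hn
    · subst hn; simp
    · simp
  simp_rw [hterm]
  rw [tsum_eq_single 0 (fun n hn => if_neg hn)]
  simp

/-- `negRecipSeq a` at `-z` is `recipSeq a` at `z`. [folklore] -/
theorem negRecipSeq_mul_neg_pow (a : ℕ → ℝ) (n : ℕ) (z : ℂ) :
    (negRecipSeq a n : ℂ) * (-z) ^ n = (recipSeq a n : ℂ) * z ^ n := by
  rw [negRecipSeq]
  push_cast
  rw [neg_pow z n]
  have h : ((-1 : ℂ)) ^ n * (-1) ^ n = 1 := by rw [← mul_pow]; norm_num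
  linear_combination ((recipSeq a n : ℂ) * z ^ n) * h

/-- And conversely `negRecipSeq a` at `z` is `recipSeq a` at `-z`. [folklore] -/
theorem negRecipSeq_mul_pow (a : ℕ → ℝ) (n : ℕ) (z : ℂ) :
    (negRecipSeq a n : ℂ) * z ^ n = (recipSeq a n : ℂ) * (-z) ^ n := by
  have := negRecipSeq_mul_neg_pow a n (-z)
  rwa [neg_neg] at this

/-! ### Theorem 2 -/

/-- **Aissen–Schoenberg–Whitney's Theorem 2 from Ando's recognition theorem.** For a Pólya
frequency sequence `a` with `a₀ = 1`: `Σ aₙ zⁿ = e^{g̃(z)} ∏ (1 + αᵢ z)/∏ (1 - βⱼ z)` near `0` with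
`g̃` entire, `αᵢ, βⱼ ≥ 0` summable, and `e^{g̃}` generating a PF sequence — the statement
`asw1952_representation` [Aissen–Edrei–Schoenberg–Whitney 1951, Thm. 2], proved by stripping the
poles of `1/f(-z)` and then of the zero-free quotient (module docstring, steps A–E), the only
non-elementary input being `ando1987_lowerTriangular_tn` [Ando 1987, Cor. 2.2].
[cite: AissenEdreiSchoenbergWhitney1951, Thm. 2] -/
theorem asw1952_representation_of_ando (hA : ando1987_lowerTriangular_tn) :
    asw1952_representation := by
  intro a hpf h0
  have ha0 : 0 < a 0 := by rw [h0]; exact one_pos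
  -- A. the reciprocal `b` and its pole stripping
  set b : ℕ → ℝ := negRecipSeq a with hbdef
  have hbPF : IsPolyaFrequencySeq b := hpf.negRecipSeq h0
  have hb0 : b 0 = 1 := negRecipSeq_zero h0
  set α : ℕ → ℝ := stripPoles b with hαdef
  set γ : ℕ → ℝ := stripLimit b with hγdef
  have hα : ∀ i, 0 ≤ α i := stripPoles_nonneg hA hbPF
  have hαs : Summable α := summable_stripPoles hA hbPF hb0
  have hγPF : IsPolyaFrequencySeq γ := isPolyaFrequencySeq_stripLimit hA hbPF
  have hγ0 : γ 0 = 1 := by rw [hγdef, stripLimit_zero hA hbPF, hb0]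
  have hγsum : ∀ z : ℂ, Summable fun n => ‖(γ n : ℂ) * z ^ n‖ := summable_stripLimit hA hbPF hb0
  set G : ℂ → ℂ := fun z => ∑' n, (γ n : ℂ) * z ^ n with hGdef
  have hGpos : ∀ x : ℝ, 0 ≤ x → 0 < ∑' n, γ n * x ^ n := fun x hx =>
    tsum_stripLimit_pos hA hbPF hb0 hx
  have hGeq : ∀ z : ℂ, ‖z‖ * α 0 < 1 →
      G z = (∑' n, (b n : ℂ) * z ^ n) * ∏' i, (1 - (α i : ℂ) * z) := fun z hz =>
    tsum_stripLimit_eq_zero hA hbPF hb0 hz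
  -- B. the reciprocal `c` of `γ`
  set c : ℕ → ℝ := negRecipSeq γ with hcdef
  have hcPF : IsPolyaFrequencySeq c := hγPF.negRecipSeq hγ0
  have hc0 : c 0 = 1 := negRecipSeq_zero hγ0
  -- C. its pole stripping
  set β : ℕ → ℝ := stripPoles c with hβdef
  set ε : ℕ → ℝ := stripLimit c with hεdef
  have hβ : ∀ j, 0 ≤ β j := stripPoles_nonneg hA hcPF
  have hβs : Summable β := summable_stripPoles hA hcPF hc0
  have hεPF : IsPolyaFrequencySeq ε := isPolyaFrequencySeq_stripLimit hA hcPF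
  have hε0 : ε 0 = 1 := by rw [hεdef, stripLimit_zero hA hcPF, hc0]
  have hεsum : ∀ z : ℂ, Summable fun n => ‖(ε n : ℂ) * z ^ n‖ := summable_stripLimit hA hcPF hc0
  set E : ℂ → ℂ := fun z => ∑' n, (ε n : ℂ) * z ^ n with hEdef
  have hEpos : ∀ x : ℝ, 0 ≤ x → 0 < ∑' n, ε n * x ^ n := fun x hx =>
    tsum_stripLimit_pos hA hcPF hc0 hx
  have hEeq : ∀ z : ℂ, ‖z‖ * β 0 < 1 →
      E z = (∑' n, (c n : ℂ) * z ^ n) * ∏' j, (1 - (β j : ℂ) * z) := fun z hz =>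
    tsum_stripLimit_eq_zero hA hcPF hc0 hz
  -- the entire functions `P_α`, `Q_β`, `E`, `G`
  have hαc : Summable fun i => ‖((α i : ℝ) : ℂ)‖ := summable_norm_ofReal hα hαs
  have hβc : Summable fun j => ‖((β j : ℝ) : ℂ)‖ := summable_norm_ofReal hβ hβs
  set P : ℂ → ℂ := fun z => ∏' i, (1 + (α i : ℂ) * z) with hPdef
  set Q : ℂ → ℂ := fun z => ∏' j, (1 - (β j : ℂ) * z) with hQdef
  have hPd : Differentiable ℂ P := differentiable_tprod_one_add hαc
  have hQd : Differentiable ℂ Q := differentiable_tprod_one_sub hβc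
  have hEd : Differentiable ℂ E := differentiable_tsum_of_summable hεsum
  have hGd : Differentiable ℂ G := differentiable_tsum_of_summable hγsum
  -- the radius `ρ`
  have hsa : 0 ≤ stripPole a := stripPole_nonneg hpf.isColumnPF
  have hσα : 0 ≤ ∑' i, α i := tsum_nonneg hα
  have hσβ : 0 ≤ ∑' j, β j := tsum_nonneg hβ
  set σ : ℝ := stripPole a + α 0 + β 0 + (∑' i, α i) + (∑' j, β j) + 1 with hσdef
  have hσ1 : 1 ≤ σ := by rw [hσdef]; linarith [hα 0, hβ 0]
  have hσ0 : 0 < σ := by linarith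
  set ρ : ℝ := σ⁻¹ with hρdef
  have hρ : 0 < ρ := inv_pos.2 hσ0
  have hsmall : ∀ z : ℂ, ‖z‖ < ρ → ∀ X : ℝ, 0 ≤ X → X ≤ σ → ‖z‖ * X < 1 := by
    intro z hz X hX0 hXσ
    calc ‖z‖ * X ≤ ‖z‖ * σ := mul_le_mul_of_nonneg_left hXσ (norm_nonneg _)
      _ < ρ * σ := mul_lt_mul_of_pos_right hz hσ0
      _ = 1 := by rw [hρdef, inv_mul_cancel₀ hσ0.ne']
  have hXa : stripPole a ≤ σ := by rw [hσdef]; linarith [hα 0, hβ 0]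
  have hXα : α 0 ≤ σ := by rw [hσdef]; linarith [hβ 0]
  have hXβ : β 0 ≤ σ := by rw [hσdef]; linarith [hα 0]
  have hXαi : ∀ i, α i ≤ σ := fun i => by
    have : α i ≤ ∑' i, α i := hαs.le_tsum i (fun j _ => hα j)
    rw [hσdef]; linarith [hα 0, hβ 0]
  have hXβj : ∀ j, β j ≤ σ := fun j => by
    have : β j ≤ ∑' j, β j := hβs.le_tsum j (fun i _ => hβ i)
    rw [hσdef]; linarith [hα 0, hβ 0]
  -- near `0`: the four identities
  have hnear : ∀ z : ℂ, ‖z‖ < ρ →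
      (∑' n, (a n : ℂ) * z ^ n) * (∑' n, (b n : ℂ) * (-z) ^ n) = 1 ∧
      G (-z) = (∑' n, (b n : ℂ) * (-z) ^ n) * P z ∧
      (∑' n, (c n : ℂ) * z ^ n) * G (-z) = 1 ∧
      E z = (∑' n, (c n : ℂ) * z ^ n) * Q z ∧
      Q z ≠ 0 ∧ Summable (fun n => ‖(a n : ℂ) * z ^ n‖) := by
    intro z hz
    have hz' : ‖-z‖ < ρ := by rwa [norm_neg]
    -- summabilities
    have haS : Summable fun n => ‖(a n : ℂ) * z ^ n‖ :=
      summable_norm_mul_pow_of_stripPole hpf.isColumnPF ha0 (hsmall z hz _ hsa hXa)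
    have hbS : Summable fun n => ‖(b n : ℂ) * (-z) ^ n‖ := by
      have := summable_stripSeq hA hbPF hb0 0 (z := -z) (hsmall (-z) hz' _ (hα 0) hXα)
      simpa using this
    have hrS : Summable fun n => ‖(recipSeq a n : ℂ) * z ^ n‖ :=
      hbS.congr fun n => by rw [hbdef, negRecipSeq_mul_neg_pow]
    have hcS : Summable fun n => ‖(c n : ℂ) * z ^ n‖ := by
      have := summable_stripSeq hA hcPF hc0 0 (z := z) (hsmall z hz _ (hβ 0) hXβ)
      simpa using this
    have hrγS : Summable fun n => ‖(recipSeq γ n : ℂ) * (-z) ^ n‖ :=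
      hcS.congr fun n => by rw [hcdef, negRecipSeq_mul_pow]
    have hγS : Summable fun n => ‖(γ n : ℂ) * (-z) ^ n‖ := hγsum (-z)
    -- (1) `f(z) g(-z) = 1`
    have e1 : (∑' n, (a n : ℂ) * z ^ n) * (∑' n, (b n : ℂ) * (-z) ^ n) = 1 := by
      have h1 : (∑' n, (b n : ℂ) * (-z) ^ n) = ∑' n, (recipSeq a n : ℂ) * z ^ n :=
        tsum_congr fun n => by rw [hbdef, negRecipSeq_mul_neg_pow]
      rw [h1]
      exact tsum_mul_tsum_recipSeq h0 haS hrS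
    -- (2) `G(-z) = g(-z) P(z)`
    have e2 : G (-z) = (∑' n, (b n : ℂ) * (-z) ^ n) * P z := by
      have h2 := hGeq (-z) (by rw [norm_neg]; exact hsmall z hz _ (hα 0) hXα)
      rw [h2]
      congr 1
      exact tprod_congr fun i => by ring
    -- (3) `C(z) G(-z) = 1`
    have e3 : (∑' n, (c n : ℂ) * z ^ n) * G (-z) = 1 := by
      have h1 : (∑' n, (c n : ℂ) * z ^ n) = ∑' n, (recipSeq γ n : ℂ) * (-z) ^ n :=
        tsum_congr fun n => by rw [hcdef, negRecipSeq_mul_pow]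
      rw [h1, mul_comm]
      exact tsum_mul_tsum_recipSeq hγ0 hγS hrγS
    -- (4) `E(z) = C(z) Q(z)`
    have e4 : E z = (∑' n, (c n : ℂ) * z ^ n) * Q z :=
      hEeq z (hsmall z hz _ (hβ 0) hXβ)
    -- (5) `Q(z) ≠ 0`
    have e5 : Q z ≠ 0 := by
      refine tprod_one_sub_ne_zero hβc fun j => ?_
      rw [Complex.norm_real, Real.norm_of_nonneg (hβ j), mul_comm]
      exact hsmall z hz _ (hβ j) (hXβj j)
    exact ⟨e1, e2, e3, e4, e5, haS⟩
  -- D. the global identity `E(z) G(-z) = Q(z)`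
  have hident : (fun z => E z * G (-z)) = Q := by
    refine AnalyticOnNhd.eq_of_frequently_eq (z₀ := (0 : ℂ))
      (analyticOnNhd_univ_iff_differentiable.2 (hEd.mul (hGd.comp differentiable_neg)))
      (analyticOnNhd_univ_iff_differentiable.2 hQd) ?_
    have hev : ∀ᶠ z : ℂ in 𝓝 0, E z * G (-z) = Q z := by
      filter_upwards [Metric.ball_mem_nhds (0 : ℂ) hρ] with z hz
      rw [Metric.mem_ball, dist_zero_right] at hz
      obtain ⟨-, -, e3, e4, -, -⟩ := hnear z hz
      rw [e4, mul_assoc, mul_comm (Q z), ← mul_assoc, e3, one_mul]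
    exact (hev.filter_mono nhdsWithin_le_nhds).frequently
  -- `E` is zero-free
  have hE0 : ∀ z : ℂ, E z ≠ 0 := by
    intro z hEz
    have hQz : Q z = 0 := by
      have this : E z * G (-z) = Q z := congrFun hident z
      rw [← this, hEz, zero_mul]
    obtain ⟨j, hj⟩ := exists_factor_eq_zero_of_tprod_one_sub_eq_zero hβc hQz
    -- `βⱼ ≠ 0` and `z = 1/βⱼ > 0`
    have hβj : β j ≠ 0 := by
      intro h0'
      rw [h0'] at hj
      simp at hj
    have hβjpos : 0 < β j := lt_of_le_of_ne (hβ j) (Ne.symm hβj)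
    have hz : z = (((β j)⁻¹ : ℝ) : ℂ) := by
      have h1 : ((β j : ℝ) : ℂ) * z = 1 := by linear_combination -hj
      have h2 : ((β j : ℝ) : ℂ) ≠ 0 := by exact_mod_cast hβj
      push_cast
      field_simp
      linear_combination h1
    have hpos := hEpos (β j)⁻¹ (inv_nonneg.2 hβjpos.le)
    have hEx : E (((β j)⁻¹ : ℝ) : ℂ) = ((∑' n, ε n * ((β j)⁻¹) ^ n : ℝ) : ℂ) := by
      rw [hEdef]
      simp only
      rw [Complex.ofReal_tsum]
      push_cast
      rfl
    rw [hz, hEx] at hEz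
    exact hpos.ne' (by exact_mod_cast hEz)
  -- E. the entire logarithm
  obtain ⟨gl, hgld, hgl⟩ := Complex.exists_eq_exp_of_forall_isExactOn isOpen_univ
    isPreconnected_univ (fun f hf => (differentiableOn_univ.1 hf).isExactOn_univ)
    hEd.differentiableOn (fun z _ => hE0 z)
  have hglD : Differentiable ℂ gl := differentiableOn_univ.1 hgld
  refine ⟨gl, ε, α, β, hglD, hα, hβ, hαs, hβs, hεPF, fun z => ?_, ρ, hρ, fun z hz => ?_⟩
  · rw [← hgl z (Set.mem_univ z)]
    exact (hεsum z).of_norm.hasSum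
  · obtain ⟨e1, e2, e3, e4, e5, haS⟩ := hnear z hz
    have hval : Complex.exp (gl z) * (∏' i, (1 + (α i : ℂ) * z)) / ∏' i, (1 - (β i : ℂ) * z) =
        ∑' n, (a n : ℂ) * z ^ n := by
      rw [← hgl z (Set.mem_univ z)]
      change E z * P z / Q z = _
      rw [e4, mul_assoc, mul_comm (Q z), ← mul_assoc, mul_div_assoc, div_self e5, mul_one]
      -- `C(z) P(z) = f(z)`: both are the inverse of `g(-z)`
      set gz : ℂ := ∑' n, (b n : ℂ) * (-z) ^ n with hgz
      have hg0 : gz ≠ 0 := by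
        intro h
        rw [h, mul_zero] at e1
        exact zero_ne_one e1
      rw [e2] at e3
      -- `(C P) gz = 1` and `f gz = 1`
      have h3 : ((∑' n, (c n : ℂ) * z ^ n) * P z) * gz = 1 := by
        rw [← e3]; ring
      calc (∑' n, (c n : ℂ) * z ^ n) * P z = gz⁻¹ := eq_inv_of_mul_eq_one_left h3
        _ = ∑' n, (a n : ℂ) * z ^ n := (eq_inv_of_mul_eq_one_left e1).symm
    rw [hval]
    exact haS.of_norm.hasSum

/-- **`aswe_edrei` from Ando's recognition theorem and Edrei's theorem.** Combining
`asw1952_representation_of_ando` with the assembly `aswe_edrei_of` (ASWERepresentation.lean):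
the Aissen–Schoenberg–Whitney–Edrei representation theorem [AESW 1951, Thm. 4 = Karlin 1968,
Ch. 8, Thm. 5.3] holds granted the two named facts `ando1987_lowerTriangular_tn` [Ando 1987,
Cor. 2.2] (finite-dimensional linear algebra) and `edrei1952_exponential_factor` [AESW 1951,
Thm. 3] (Nevanlinna theory). [cite: AissenEdreiSchoenbergWhitney1951, Thm. 4] -/
theorem aswe_edrei_of_ando (hA : ando1987_lowerTriangular_tn) (h3 : edrei1952_exponential_factor) :
    aswe_edrei :=
  aswe_edrei_of (asw1952_representation_of_ando hA) h3

end Literature.Analysis.TotalPositivity
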